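import Literature.Geometry.Kaehler.HolomorphicLineBundleCech
import Literature.Geometry.Kaehler.HolomorphicLineBundleSectionsFinite
import HarnessLib

/-!
# `Ȟ⁰(𝔙, 𝒪(L)) = Γ(M, L)`: degree zero of the Čech complex of a cocycle line bundle

Layer `Literature/Geometry/Kaehler`, joining `HolomorphicLineBundleCech` (the Čech complex
`C^•(𝔙, 𝒪(L))` of the sheaf of sections of a cocycle line bundle `L` on a framed cover
`𝔙 = (V_k, frame k)`, sections over `V_J` written in the frame of the first index) and
`HolomorphicLineBundleSectionsFinite` (the section space `Γ(M, L) = L.sectionSpace` and the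
finiteness of `h⁰` on compact manifolds). For a framed cover which COVERS `M`:

* `FramedCover.toCochain C : Γ(M, L) → C⁰(𝔙, 𝒪(L))`, `s ↦ (s_{frame k}|_{V_k})_k`, with values in
  the `0`-cocycles (`delta_toCochain`);
* `FramedCover.glue C hcov c` — the section of `L` glued from a `0`-cocycle `c` (in the frame `σ_a`
  over `U_a`: `g_{frame k, a} c_k` on `V_k ∩ U_a`, independent of `k` by the cocycle condition),
  `glue_apply_of_mem`;
* **`FramedCover.sectionSpaceEquivCocycles`** — the linear isomorphism
  `Γ(M, L) ≃ₗ[ℂ] Z⁰(𝔙, 𝒪(L))`, and **`FramedCover.sectionSpaceEquivCohomology`** —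
  `Γ(M, L) ≃ₗ[ℂ] Ȟ⁰(𝔙, 𝒪(L))` (there are no `0`-coboundaries): Voisin I, proof of Thm. 4.49 /
  Godement II.5.2, `Ȟ⁰(𝔙, 𝓕) = 𝓕(M)` for a sheaf `𝓕`;
* `FramedCover.finite_cohomology_zero`, `FramedCover.finrank_cohomology_zero` — hence on a COMPACT
  complex manifold `Ȟ⁰(𝔙, 𝒪(L))` is finite-dimensional, of dimension `h⁰(M, L)`, for every covering
  framed cover (Cartan–Serre in degree `0`, `finiteDimensional_sectionSpace`).

Everything is proved; the definitions are the three maps.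

## References

* C. Voisin, *Hodge Theory and Complex Algebraic Geometry I* (2002), Thm. 4.49 (proof), §4.3.1.
  [VoisinHodgeI2002]
* J.-P. Serre, *Faisceaux algébriques cohérents* (1955), n° 18, n° 20 Prop. 2 (`H⁰(𝔘, 𝓕) = Γ(X, 𝓕)`).
  [SerreFAC1955]
-/

noncomputable section

open scoped Manifold ContDiff Topology
open Set Filter Function Literature.Algebra.Homology

namespace Literature.Geometry.Kaehler

namespace HolomorphicLineBundle

namespace FramedCover

variable {ι κ : Type*} {E : Type*} [NormedAddCommGroup E] [NormedSpace ℂ E]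
  {M : Type*} [TopologicalSpace M] [ChartedSpace E M]
  {L : HolomorphicLineBundle ι E M} (C : L.FramedCover κ)

/-! ### From sections to `0`-cocycles -/

/-- The coordinate `s_a` of a section, as an element of `𝒪(U_a)` (it is holomorphic on `U_a` and
normalised to `0` off `U_a`). [folklore] -/
def coordHolFun (a : ι) : L.sectionSpace →ₗ[ℂ] ↥(holFunOn E (L.baseSet a)) where
  toFun s := ⟨(s : ι → M → ℂ) a, mdifferentiableOn_of_mem_sectionSpace s a,
    fun _ hx ↦ apply_eq_zero_of_notMem s a hx⟩
  map_add' _ _ := rfl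
  map_smul' _ _ := rfl

/-- The underlying function of `coordHolFun` (definitional). [folklore] -/
@[simp]
theorem coe_coordHolFun (a : ι) (s : L.sectionSpace) :
    (coordHolFun a s : M → ℂ) = (s : ι → M → ℂ) a :=
  rfl

/-- **Sections to `0`-cochains**: `s ↦ (s_{frame (J 0)}|_{V_J})_J`. [cite: VoisinHodgeI2002, Thm. 4.49 (proof)] -/
def toCochain : L.sectionSpace →ₗ[ℂ] C.Cochain 0 :=
  LinearMap.pi fun J ↦ holFunOn.mulRestrict (E := E) (C.cechSet_subset_baseSet J 0) (g := fun _ ↦ (1 : ℂ))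
    mdifferentiableOn_const ∘ₗ coordHolFun (C.frame (J 0))

/-- `toCochain` at a point of `V_J`. [folklore] -/
theorem toCochain_apply_apply_of_mem (s : L.sectionSpace) {J : Fin 1 → κ} {x : M}
    (hx : x ∈ cechSet C.U J) :
    (C.toCochain s J : M → ℂ) x = (s : ι → M → ℂ) (C.frame (J 0)) x := by
  change (holFunOn.mulRestrict (E := E) (C.cechSet_subset_baseSet J 0) (g := fun _ ↦ (1 : ℂ))
    mdifferentiableOn_const (coordHolFun (C.frame (J 0)) s) : M → ℂ) x = _
  rw [holFunOn.mulRestrict_apply_of_mem _ _ _ hx, one_mul, coe_coordHolFun]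

/-- `toCochain` at a point of `V_k`, single-index form. [folklore] -/
theorem toCochain_single_apply_of_mem (s : L.sectionSpace) {k : κ} {x : M} (hx : x ∈ C.U k) :
    (C.toCochain s ![k] : M → ℂ) x = (s : ι → M → ℂ) (C.frame k) x :=
  C.toCochain_apply_apply_of_mem s (J := ![k]) (by rwa [cechSet_fin_one])

/-- **The `0`-cochain of a section is a cocycle** (the transformation rule `s_b = g_ab s_a`).
[cite: VoisinHodgeI2002, Thm. 4.49 (proof)] -/
theorem delta_toCochain (s : L.sectionSpace) : C.delta 0 (C.toCochain s) = 0 := by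
  rw [C.delta_zero_eq_zero_iff]
  intro k l x hx
  rw [C.toCochain_single_apply_of_mem s hx.2, C.toCochain_single_apply_of_mem s hx.1]
  exact apply_eq_mul_of_mem_sectionSpace s (C.frame k) (C.frame l) ⟨C.subset k hx.1, C.subset l hx.2⟩

/-- `toCochain` with values in the `0`-cocycles `Z⁰(𝔙, 𝒪(L))`. [folklore] -/
def toCocycles : L.sectionSpace →ₗ[ℂ] ↥(NatCochain.cocycles (R := ℂ) (fun a ↦ C.delta a) 0) :=
  LinearMap.codRestrict _ C.toCochain fun s ↦
    (NatCochain.mem_cocycles_iff (R := ℂ) (fun a ↦ C.delta a)).2 (C.delta_toCochain s)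

/-- The underlying cochain of `toCocycles s` (definitional). [folklore] -/
@[simp]
theorem coe_toCocycles (s : L.sectionSpace) : (C.toCocycles s : C.Cochain 0) = C.toCochain s :=
  rfl

/-! ### From `0`-cocycles to sections: gluing -/

section Glue

variable (hcov : ∀ x : M, ∃ k, x ∈ C.U k)

open Classical in
/-- **The section glued from a `0`-cocycle** of a COVERING framed cover: in the frame `σ_a` over
`U_a` its coordinate at `x` is `g_{frame k, a}(x) c_k(x)` for the chosen member `V_k ∋ x`
(independent of the choice for cocycles, `glue_apply_of_mem`); `0` off `U_a`.
[cite: VoisinHodgeI2002, Thm. 4.49 (proof)] -/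
def glue (c : C.Cochain 0) : ι → M → ℂ := fun a x ↦
  if x ∈ L.baseSet a then
    L.coordChange (C.frame (Classical.choose (hcov x))) a x * (c ![Classical.choose (hcov x)] : M → ℂ) x
  else 0

/-- Off `U_a` the glued coordinate vanishes. [folklore] -/
theorem glue_apply_of_notMem (c : C.Cochain 0) {a : ι} {x : M} (hx : x ∉ L.baseSet a) :
    C.glue hcov c a x = 0 := by
  classical
  exact if_neg hx

/-- **The glued coordinate in the frame `σ_a` is `g_{frame k, a} c_k` on `V_k ∩ U_a` for EVERY
`k`**, when `c` is a cocycle (`c_l = g_{frame k, frame l} c_k` on `V_k ∩ V_l` and the cocycle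
condition of `g`). [cite: VoisinHodgeI2002, Thm. 4.49 (proof)] -/
theorem glue_apply_of_mem {c : C.Cochain 0} (hc : C.delta 0 c = 0) {a : ι} {k : κ} {x : M}
    (hx : x ∈ C.U k) (hxa : x ∈ L.baseSet a) :
    C.glue hcov c a x = L.coordChange (C.frame k) a x * (c ![k] : M → ℂ) x := by
  classical
  set k₀ := Classical.choose (hcov x) with hk₀
  have hx₀ : x ∈ C.U k₀ := Classical.choose_spec (hcov x)
  rw [glue, if_pos hxa]
  change L.coordChange (C.frame k₀) a x * (c ![k₀] : M → ℂ) x = _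
  rw [(C.delta_zero_eq_zero_iff c).1 hc k k₀ x ⟨hx, hx₀⟩, ← mul_assoc, mul_comm (L.coordChange _ a x),
    L.coordChange_comp (C.frame k) (C.frame k₀) a x ⟨⟨C.subset k hx, C.subset k₀ hx₀⟩, hxa⟩]

/-- **The glued family of a `0`-cocycle is a section of `L`** (holomorphic framewise — locally a
transition function times a component of `c` —, with the transformation rule by the cocycle condition
of `g`, normalised). [cite: VoisinHodgeI2002, Thm. 4.49 (proof)] -/
theorem glue_mem_sectionSpace {c : C.Cochain 0} (hc : C.delta 0 c = 0) : C.glue hcov c ∈ L.sectionSpace := by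
  refine ⟨fun a x₀ hx₀ ↦ ?_, fun a b x hx ↦ ?_, fun a x hx ↦ C.glue_apply_of_notMem hcov c hx⟩
  · -- holomorphy near `x₀ ∈ U_a`, through a member `V_k ∋ x₀`
    obtain ⟨k, hk⟩ := hcov x₀
    set O : Set M := C.U k ∩ L.baseSet a with hO
    have hOo : IsOpen O := (C.isOpen k).inter (L.isOpen_baseSet a)
    have hx₀O : x₀ ∈ O := ⟨hk, hx₀⟩
    have hF : MDifferentiableOn 𝓘(ℂ, E) 𝓘(ℂ, ℂ)
        (fun x ↦ L.coordChange (C.frame k) a x * (c ![k] : M → ℂ) x) O :=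
      ((L.mdifferentiableOn_coordChange (C.frame k) a).mono fun x hx ↦ ⟨C.subset k hx.1, hx.2⟩).mul
        ((holFunOn.mdifferentiableOn (c ![k])).mono fun x hx ↦ by
          rw [cechSet_fin_one]; exact hx.1)
    have hFat : MDifferentiableAt 𝓘(ℂ, E) 𝓘(ℂ, ℂ)
        (fun x ↦ L.coordChange (C.frame k) a x * (c ![k] : M → ℂ) x) x₀ :=
      (hF x₀ hx₀O).mdifferentiableAt (hOo.mem_nhds hx₀O)
    have hev : C.glue hcov c a =ᶠ[𝓝 x₀] fun x ↦ L.coordChange (C.frame k) a x * (c ![k] : M → ℂ) x := by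
      filter_upwards [hOo.mem_nhds hx₀O] with x hx
      exact C.glue_apply_of_mem hcov hc hx.1 hx.2
    exact (hFat.congr_of_eventuallyEq hev).mdifferentiableWithinAt
  · -- the transformation rule
    obtain ⟨k, hk⟩ := hcov x
    rw [C.glue_apply_of_mem hcov hc hk hx.1, C.glue_apply_of_mem hcov hc hk hx.2, ← mul_assoc,
      mul_comm (L.coordChange a b x),
      L.coordChange_comp (C.frame k) a b x ⟨⟨C.subset k hk, hx.1⟩, hx.2⟩]

/-- **`0`-cocycles to sections**, a linear map `Z⁰(𝔙, 𝒪(L)) → Γ(M, L)`.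
[cite: VoisinHodgeI2002, Thm. 4.49 (proof)] -/
def ofCocycles : ↥(NatCochain.cocycles (R := ℂ) (fun a ↦ C.delta a) 0) →ₗ[ℂ] L.sectionSpace where
  toFun c := ⟨C.glue hcov c, C.glue_mem_sectionSpace hcov
    ((NatCochain.mem_cocycles_iff (R := ℂ) (fun a ↦ C.delta a)).1 c.2)⟩
  map_add' c c' := by
    classical
    refine Subtype.ext (funext fun a ↦ funext fun x ↦ ?_)
    change C.glue hcov (c + c' : C.Cochain 0) a x = C.glue hcov c a x + C.glue hcov c' a x
    by_cases hx : x ∈ L.baseSet a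
    · simp only [glue, if_pos hx, Pi.add_apply, Submodule.coe_add, mul_add]
    · simp only [glue, if_neg hx, add_zero]
  map_smul' r c := by
    classical
    refine Subtype.ext (funext fun a ↦ funext fun x ↦ ?_)
    change C.glue hcov (r • c : C.Cochain 0) a x = r • C.glue hcov c a x
    by_cases hx : x ∈ L.baseSet a
    · simp only [glue, if_pos hx, Pi.smul_apply, Submodule.coe_smul, smul_eq_mul]
      ring
    · simp only [glue, if_neg hx, smul_zero]

/-- The coordinates of `ofCocycles c` (definitional). [folklore] -/
theorem coe_ofCocycles (c : ↥(NatCochain.cocycles (R := ℂ) (fun a ↦ C.delta a) 0)) :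
    (C.ofCocycles hcov c : ι → M → ℂ) = C.glue hcov c :=
  rfl

/-- `toCochain ∘ ofCocycles = id` on `0`-cocycles. [cite: VoisinHodgeI2002, Thm. 4.49 (proof)] -/
theorem toCocycles_ofCocycles (c : ↥(NatCochain.cocycles (R := ℂ) (fun a ↦ C.delta a) 0)) :
    C.toCocycles (C.ofCocycles hcov c) = c := by
  have hc : C.delta 0 (c : C.Cochain 0) = 0 :=
    (NatCochain.mem_cocycles_iff (R := ℂ) (fun a ↦ C.delta a)).1 c.2
  refine Subtype.ext (funext fun J ↦ Subtype.ext (funext fun x ↦ ?_))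
  rw [coe_toCocycles]
  by_cases hx : x ∈ cechSet C.U J
  · have hxk : x ∈ C.U (J 0) := cechSet_subset_apply C.U J 0 hx
    have hJ : J = ![J 0] := by
      funext i; fin_cases i; rfl
    rw [C.toCochain_apply_apply_of_mem _ hx, coe_ofCocycles,
      C.glue_apply_of_mem hcov hc hxk (C.subset _ hxk), L.coordChange_self _ (C.subset _ hxk), one_mul,
      ← hJ]
  · rw [holFunOn.apply_of_notMem _ hx, holFunOn.apply_of_notMem _ hx]

/-- `ofCocycles ∘ toCochain = id` on sections. [cite: VoisinHodgeI2002, Thm. 4.49 (proof)] -/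
theorem ofCocycles_toCocycles (s : L.sectionSpace) : C.ofCocycles hcov (C.toCocycles s) = s := by
  refine Subtype.ext (funext fun a ↦ funext fun x ↦ ?_)
  rw [coe_ofCocycles]
  by_cases hxa : x ∈ L.baseSet a
  · obtain ⟨k, hk⟩ := hcov x
    rw [coe_toCocycles, C.glue_apply_of_mem hcov (C.delta_toCochain s) hk hxa,
      C.toCochain_single_apply_of_mem s hk]
    exact (apply_eq_mul_of_mem_sectionSpace s (C.frame k) a ⟨C.subset k hk, hxa⟩).symm
  · rw [C.glue_apply_of_notMem hcov _ hxa, apply_eq_zero_of_notMem s a hxa]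

/-- **`Γ(M, L) ≃ Z⁰(𝔙, 𝒪(L))`** for a covering framed cover. [cite: VoisinHodgeI2002, Thm. 4.49 (proof)] -/
def sectionSpaceEquivCocycles :
    L.sectionSpace ≃ₗ[ℂ] ↥(NatCochain.cocycles (R := ℂ) (fun a ↦ C.delta a) 0) :=
  LinearEquiv.ofLinear C.toCocycles (C.ofCocycles hcov)
    (LinearMap.ext fun c ↦ C.toCocycles_ofCocycles hcov c)
    (LinearMap.ext fun s ↦ C.ofCocycles_toCocycles hcov s)

/-- The class map `Z⁰ → Ȟ⁰` is a linear isomorphism (there are no `0`-coboundaries). [folklore] -/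
theorem bijective_mk_zero :
    Bijective (NatCochain.Cohomology.mk (R := ℂ) (fun a ↦ C.delta a) 0) := by
  refine ⟨(injective_iff_map_eq_zero _).2 fun z hz ↦ ?_, NatCochain.Cohomology.mk_surjective _ 0⟩
  rw [NatCochain.Cohomology.mk_eq_zero_iff, NatCochain.coboundaries_zero, Submodule.mem_bot] at hz
  exact Subtype.ext hz

/-- **`Γ(M, L) ≃ Ȟ⁰(𝔙, 𝒪(L))`** for a covering framed cover: the degree-`0` Čech cohomology of
the sheaf of sections is the space of global sections. [cite: SerreFAC1955, n° 20 Prop. 2] -/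
def sectionSpaceEquivCohomology : L.sectionSpace ≃ₗ[ℂ] C.cohomology 0 :=
  (C.sectionSpaceEquivCocycles hcov).trans
    (LinearEquiv.ofBijective (NatCochain.Cohomology.mk (R := ℂ) (fun a ↦ C.delta a) 0)
      (C.bijective_mk_zero))

include hcov in
/-- **Finiteness of `Ȟ⁰(𝔙, 𝒪(L))` on a compact complex manifold** (Cartan–Serre in degree `0`:
`finiteDimensional_sectionSpace` transported). [cite: CartanSerre1953] -/
theorem finite_cohomology_zero [FiniteDimensional ℂ E] [T2Space M] [CompactSpace M]
    [IsManifold 𝓘(ℂ, E) ω M] : Module.Finite ℂ (C.cohomology 0) := by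
  haveI := L.finiteDimensional_sectionSpace
  exact Module.Finite.equiv (C.sectionSpaceEquivCohomology hcov)

include hcov in
/-- **`dim Ȟ⁰(𝔙, 𝒪(L)) = h⁰(M, L)`** for every covering framed cover. [cite: SerreFAC1955, n° 20 Prop. 2] -/
theorem finrank_cohomology_zero : Module.finrank ℂ (C.cohomology 0) = L.h0 :=
  ((C.sectionSpaceEquivCohomology hcov).finrank_eq).symm

end Glue

end FramedCover

end HolomorphicLineBundle

end Literature.Geometry.Kaehler
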